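import Summits.Schanuel.Schanuel.Theses.TateNomes
import Literature.Barriers.Schanuel.NesterenkoModularScopeValuesProofs
import Literature.Barriers.Schanuel.AlgebraicIndependenceOfLogarithms

/-!
# `TateLocusGPCOne` (crux stmt-Schanuel-17406, route `TateNomes`): the non-quadratic clause is
# load-bearing, and the bound `5` cannot be raised — negative-side support (refuter crux-attack seat)

`TateLocusGPCOne` claims: for `Im τ > 0` with `τ` not a root of a monic rational quadratic,
`5 ≤ trdeg_ℚ ℚ(2πi, τ, q, P(q), Q(q), R(q))`, `q = e^{2πiτ}`, `P, Q, R` Ramanujan's `q`-series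
(written inline in the route file; definitionally `Literature.Barriers.Schanuel.ramanujanP/Q/R`).

Recorded here, sorry-free:

* `tateLocusGPCOne_false_without_nonQuadratic` — dropping the non-quadratic clause makes the
  statement FALSE: at the CM point `τ = i` one has `R(e^{−2π}) = E₆(i) = 0`
  (`Literature.Barriers.Schanuel.ramanujanR_exp_neg_two_pi`) and `i ∈ ℚ̄`, so the six generators
  give `trdeg ≤ 4 < 5` (indeed `= 3` by Nesterenko/Chudnovsky, not needed). Any proof must use
  the non-CM hypothesis; the CM calibration value is `3`, two below the claim.
* `not_tateLocusGPCOne_six` — the natural strengthening `6 ≤ trdeg` (all six numbers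
  algebraically independent) is FALSE under the item's own hypotheses: at the algebraic,
  non-quadratic `τ = i·2^{1/4}` (`τ⁴ = 2`, `τ² = −√2 ∉ ℚ`) the field is generated by six elements
  one of which is algebraic, so `trdeg ≤ 5`. The item's `5` is the most one can ask uniformly.
* `tateLocusGPCOne_hypotheses_satisfiable` — the hypotheses are met (by the same `τ`), so the
  item is not vacuous.

This file does NOT refute the crux (an instance of André's generalized period conjecture,
Bertolin–Waldschmidt arXiv:2504.14048 Conj. 2.1 at `(s,n) = (1,2)`).
-/

noncomputable section

set_option linter.dupNamespace false

namespace Summit.Schanuel.Schanuel.Theorems.TateLocusGPCOne.Negative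

open Complex IntermediateField
open Literature.Barriers.Schanuel

/-- Six generators, two of them algebraic over `ℚ`, generate a field of transcendence degree
`≤ 4`. [folklore] -/
theorem trdeg_adjoin_six_le_four_of_isAlgebraic {a b c d e f : ℂ} (hb : IsAlgebraic ℚ b)
    (hf : IsAlgebraic ℚ f) :
    Algebra.trdeg ℚ (adjoin ℚ ({a, b, c, d, e, f} : Set ℂ)) ≤ (4 : Cardinal) := by
  have hle : adjoin ℚ ({a, b, c, d, e, f} : Set ℂ) ≤ adjoin ℚ (Set.range ![a, c, d, e] ∪ {b, f}) := by
    refine adjoin.mono ℚ _ _ ?_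
    intro x hx
    simp only [Set.mem_insert_iff, Set.mem_singleton_iff] at hx
    rcases hx with rfl | rfl | rfl | rfl | rfl | rfl
    · exact Or.inl ⟨0, by simp⟩
    · exact Or.inr (Set.mem_insert _ _)
    · exact Or.inl ⟨1, by simp⟩
    · exact Or.inl ⟨2, by simp⟩
    · exact Or.inl ⟨3, by simp⟩
    · exact Or.inr (Set.mem_insert_of_mem _ rfl)
  calc Algebra.trdeg ℚ (adjoin ℚ ({a, b, c, d, e, f} : Set ℂ))
      ≤ Algebra.trdeg ℚ (adjoin ℚ (Set.range ![a, c, d, e] ∪ {b, f})) :=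
        trdeg_le_of_injective (inclusion hle) (inclusion_injective hle)
    _ = Algebra.trdeg ℚ (adjoin ℚ (Set.range ![a, c, d, e])) := by
        refine trdeg_adjoin_union_eq_of_isAlgebraic _ _ ?_
        rintro x (rfl | hx)
        · exact hb
        · rw [Set.mem_singleton_iff.mp hx]
          exact hf
    _ ≤ (4 : Cardinal) := by
        exact_mod_cast
          Literature.NumberTheory.Transcendental.Philippon1986_criterion.trdeg_adjoin_range_le
            ![a, c, d, e]

/-- Six generators, one of them algebraic over `ℚ`, generate a field of transcendence degree
`≤ 5`. [folklore] -/
theorem trdeg_adjoin_six_le_five_of_isAlgebraic {a b c d e f : ℂ} (hb : IsAlgebraic ℚ b) :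
    Algebra.trdeg ℚ (adjoin ℚ ({a, b, c, d, e, f} : Set ℂ)) ≤ (5 : Cardinal) := by
  have hle : adjoin ℚ ({a, b, c, d, e, f} : Set ℂ) ≤ adjoin ℚ (Set.range ![a, c, d, e, f] ∪ {b}) := by
    refine adjoin.mono ℚ _ _ ?_
    intro x hx
    simp only [Set.mem_insert_iff, Set.mem_singleton_iff] at hx
    rcases hx with rfl | rfl | rfl | rfl | rfl | rfl
    · exact Or.inl ⟨0, by simp⟩
    · exact Or.inr rfl
    · exact Or.inl ⟨1, by simp⟩
    · exact Or.inl ⟨2, by simp⟩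
    · exact Or.inl ⟨3, by simp⟩
    · exact Or.inl ⟨4, by simp⟩
  calc Algebra.trdeg ℚ (adjoin ℚ ({a, b, c, d, e, f} : Set ℂ))
      ≤ Algebra.trdeg ℚ (adjoin ℚ (Set.range ![a, c, d, e, f] ∪ {b})) :=
        trdeg_le_of_injective (inclusion hle) (inclusion_injective hle)
    _ = Algebra.trdeg ℚ (adjoin ℚ (Set.range ![a, c, d, e, f])) := by
        refine trdeg_adjoin_union_eq_of_isAlgebraic _ _ ?_
        intro x hx
        rw [Set.mem_singleton_iff.mp hx]
        exact hb
    _ ≤ (5 : Cardinal) := by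
        exact_mod_cast
          Literature.NumberTheory.Transcendental.Philippon1986_criterion.trdeg_adjoin_range_le
            ![a, c, d, e, f]

/-- **Dropping "τ non-quadratic" makes `TateLocusGPCOne` false** (witness: the CM point `τ = i`,
where `R(e^{−2π}) = E₆(i) = 0` and `i ∈ ℚ̄` force `trdeg ℚ(2πi, i, e^{−2π}, P, Q, R) ≤ 4`). The
dropped-hypothesis statement is written inline, with the route file's own spelling of `P, Q, R`. -/
theorem tateLocusGPCOne_false_without_nonQuadratic :
    ¬ (∀ τ : ℂ, 0 < τ.im → (5 : Cardinal) ≤ Algebra.trdeg ℚ ↥(IntermediateField.adjoin ℚ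
        ({2 * (Real.pi : ℂ) * Complex.I, τ, Complex.exp (2 * Real.pi * Complex.I * τ),
          1 - 24 * ∑' l : ℕ, (ArithmeticFunction.sigma 1 (l + 1) : ℂ) *
            Complex.exp (2 * Real.pi * Complex.I * τ) ^ (l + 1),
          1 + 240 * ∑' l : ℕ, (ArithmeticFunction.sigma 3 (l + 1) : ℂ) *
            Complex.exp (2 * Real.pi * Complex.I * τ) ^ (l + 1),
          1 - 504 * ∑' l : ℕ, (ArithmeticFunction.sigma 5 (l + 1) : ℂ) *
            Complex.exp (2 * Real.pi * Complex.I * τ) ^ (l + 1)} : Set ℂ))) := by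
  intro h
  have h5 := h Complex.I (by simp)
  -- the sixth generator is `R(e^{2πi·i}) = E₆(i) = 0`
  have hR : 1 - 504 * ∑' l : ℕ, (ArithmeticFunction.sigma 5 (l + 1) : ℂ) *
      Complex.exp (2 * Real.pi * Complex.I * Complex.I) ^ (l + 1) = 0 := by
    change ramanujanR (cexp (2 * Real.pi * I * ((UpperHalfPlane.I : UpperHalfPlane) : ℂ))) = 0
    rw [ramanujanR_cexp]
    exact Literature.NumberTheory.EllipticCurves.ModularForms.E₆_I
  have h4 := trdeg_adjoin_six_le_four_of_isAlgebraic
    (a := 2 * (Real.pi : ℂ) * Complex.I) (c := Complex.exp (2 * Real.pi * Complex.I * Complex.I))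
    (d := 1 - 24 * ∑' l : ℕ, (ArithmeticFunction.sigma 1 (l + 1) : ℂ) *
            Complex.exp (2 * Real.pi * Complex.I * Complex.I) ^ (l + 1))
    (e := 1 + 240 * ∑' l : ℕ, (ArithmeticFunction.sigma 3 (l + 1) : ℂ) *
            Complex.exp (2 * Real.pi * Complex.I * Complex.I) ^ (l + 1))
    isAlgebraic_I (hR ▸ isAlgebraic_zero)
  have : (5 : Cardinal) ≤ 4 := h5.trans h4
  norm_num at this

/-- `Im τ₀ = 2^{1/4} > 0`. -/
private theorem τ₀_im_pos : 0 < Complex.im (Complex.mk 0 (Real.sqrt (Real.sqrt 2))) := by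
  show 0 < Real.sqrt (Real.sqrt 2)
  exact Real.sqrt_pos.mpr (Real.sqrt_pos.mpr two_pos)

/-- `τ₀² = −√2`. -/
private theorem τ₀_sq : (Complex.mk 0 (Real.sqrt (Real.sqrt 2))) ^ 2 = -((Real.sqrt 2 : ℝ) : ℂ) := by
  apply Complex.ext
  · simp [sq, Real.mul_self_sqrt (Real.sqrt_nonneg 2)]
  · simp [sq]

/-- `τ₀ = i·2^{1/4}` is not a root of a monic rational quadratic (`τ₀² = −√2` is irrational). -/
private theorem τ₀_nonQuadratic :
    ∀ b c : ℚ, (Complex.mk 0 (Real.sqrt (Real.sqrt 2))) ^ 2 + (b : ℂ) * (Complex.mk 0 (Real.sqrt (Real.sqrt 2))) + (c : ℂ) ≠ 0 := by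
  intro b c h
  rw [τ₀_sq] at h
  -- real parts: `-√2 + (b·0 − 0·Im τ₀) + c = 0`, i.e. `c = √2`, contradicting irrationality
  have hre := congrArg Complex.re h
  simp only [Complex.add_re, Complex.neg_re, Complex.ofReal_re, Complex.mul_re,
    Complex.ratCast_re, Complex.ratCast_im, Complex.zero_re] at hre
  have hc : (c : ℝ) = Real.sqrt 2 := by linarith
  exact irrational_sqrt_two ⟨c, hc⟩

/-- `τ₀ = i·2^{1/4}` is algebraic (root of `X⁴ − 2`… via `τ₀² = −√2`, `(τ₀²)² = 2`). -/
private theorem isAlgebraic_τ₀ : IsAlgebraic ℚ (Complex.mk 0 (Real.sqrt (Real.sqrt 2))) := by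
  refine ⟨Polynomial.X ^ 4 - 2, fun h => ?_, ?_⟩
  · have h0 := congrArg (Polynomial.eval 0) h
    norm_num at h0
  · simp only [map_sub, map_pow, Polynomial.aeval_X, map_ofNat]
    rw [show (Complex.mk 0 (Real.sqrt (Real.sqrt 2))) ^ 4 = ((Complex.mk 0 (Real.sqrt (Real.sqrt 2))) ^ 2) ^ 2 by ring, τ₀_sq, neg_sq, ← Complex.ofReal_pow,
      Real.sq_sqrt zero_le_two]
    norm_num

/-- **The hypotheses of `TateLocusGPCOne` are satisfiable** (it is not vacuous): `τ = i·2^{1/4}`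
has `Im τ > 0` and is not a root of a monic rational quadratic. -/
theorem tateLocusGPCOne_hypotheses_satisfiable :
    ∃ τ : ℂ, 0 < τ.im ∧ ∀ b c : ℚ, τ ^ 2 + (b : ℂ) * τ + (c : ℂ) ≠ 0 :=
  ⟨_, τ₀_im_pos, τ₀_nonQuadratic⟩

/-- **The strengthening `6 ≤ trdeg` of `TateLocusGPCOne` is false** under the item's own
hypotheses: at the algebraic non-quadratic `τ = i·2^{1/4}` the six generators include an
algebraic one, so `trdeg ≤ 5 < 6`. (So `5` is the largest uniform bound one can claim.) -/
theorem not_tateLocusGPCOne_six :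
    ¬ (∀ τ : ℂ, 0 < τ.im → (∀ b c : ℚ, τ ^ 2 + (b : ℂ) * τ + (c : ℂ) ≠ 0) →
      (6 : Cardinal) ≤ Algebra.trdeg ℚ ↥(IntermediateField.adjoin ℚ
        ({2 * (Real.pi : ℂ) * Complex.I, τ, Complex.exp (2 * Real.pi * Complex.I * τ),
          1 - 24 * ∑' l : ℕ, (ArithmeticFunction.sigma 1 (l + 1) : ℂ) *
            Complex.exp (2 * Real.pi * Complex.I * τ) ^ (l + 1),
          1 + 240 * ∑' l : ℕ, (ArithmeticFunction.sigma 3 (l + 1) : ℂ) *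
            Complex.exp (2 * Real.pi * Complex.I * τ) ^ (l + 1),
          1 - 504 * ∑' l : ℕ, (ArithmeticFunction.sigma 5 (l + 1) : ℂ) *
            Complex.exp (2 * Real.pi * Complex.I * τ) ^ (l + 1)} : Set ℂ))) := by
  intro h
  have h6 := h _ τ₀_im_pos τ₀_nonQuadratic
  have : (6 : Cardinal) ≤ 5 :=
    h6.trans (trdeg_adjoin_six_le_five_of_isAlgebraic (hb := isAlgebraic_τ₀))
  norm_num at this

/-- Sanity link to the route decl: `TateLocusGPCOne` is exactly the `5 ≤ trdeg` statement whose
`6 ≤` strengthening is refuted above and whose non-quadratic clause is shown load-bearing. -/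
example : Summit.Schanuel.Schanuel.Theses.TateNomes.TateLocusGPCOne ↔
    ∀ τ : ℂ, 0 < τ.im → (∀ b c : ℚ, τ ^ 2 + (b : ℂ) * τ + (c : ℂ) ≠ 0) →
      (5 : Cardinal) ≤ Algebra.trdeg ℚ ↥(IntermediateField.adjoin ℚ
        ({2 * (Real.pi : ℂ) * Complex.I, τ, cexp (2 * Real.pi * I * τ),
          ramanujanP (cexp (2 * Real.pi * I * τ)), ramanujanQ (cexp (2 * Real.pi * I * τ)),
          ramanujanR (cexp (2 * Real.pi * I * τ))} : Set ℂ)) :=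
  Iff.rfl

end Summit.Schanuel.Schanuel.Theorems.TateLocusGPCOne.Negative

end
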